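import Summits.ResolutionOfSingularities.ResolutionOfSingularities.Theorems.FrobeniusClosingSteerK7HatFrame
import Summits.ResolutionOfSingularities.ResolutionOfSingularities.Theorems.FrobeniusClosingSteerK7HatBranchTransfer
import Summits.ResolutionOfSingularities.ResolutionOfSingularities.Theorems.FrobeniusClosingSteerK7HatBranchObstruction
import Summits.ResolutionOfSingularities.ResolutionOfSingularities.Theorems.FrobeniusClosingSteerK7HatBranchConclusion
import HarnessLib

/-!
# K-β7-hat — `FormalCentreDescent` HOLDS (β-slot hβ6′ of the W4.1 leaf `hK4_of_betaHat`; OURS)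

The ASSEMBLY of res-L0-w41-idea-1's kernel decomposition (`K7HatWords-idea-1-g12.lean` cbdb8a4f311bfcb9 = tree
`…SteerK7HatWords`, res-D-pv-035 p555432; memo `CANONICAL-CLEANING-g10.md` §12; res-L0-w41-plan-1 RULINGS 237(b),
241(c), 253): the tree's sorry-free `K7Hat.formalCentreDescent_of : HatFrame → BranchTransfer → BranchObstruction →
BranchConclusion → FormalCentreDescent` fed BY NAME with the four landed pieces

* F0 `K7HatFrame.hatFrame_holds` (res-D-pv-035, p556572),
* W1 `K7HatBranchTransfer.branchTransfer_holds` (res-L0-w41-idea-3 with res-L0-w44-stub-3 / res-D-pv-035 / res-D-pv-028, p560709),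
* W2 `BranchFinal.branchObstruction_holds` (res-D-pv-036, p561159 — the heart: odd anisotropic cones admit no second
  formal branch),
* W3 `K7HatBranchConclusion.branchConclusion_holds` (res-D-pv-035, p556662).

`K7Hat.FormalCentreDescent` is character-identical to the β-leaf's binder hβ6′ (idea-1's leaf of record), so the leaf
consumes `formalCentreDescent_holds` by `δ`-unfolding. Everything here is OURS (the run's own bookkeeping), AI-written
and AI-checked only — weaker than expert review; nothing is a statement of [Hironaka2017]. -/

set_option linter.dupNamespace false
set_option autoImplicit false

namespace Summit.ResolutionOfSingularities.ResolutionOfSingularities.Theorems.SwitchingDichotomy.K7HatFormalCentreDescent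

open Summit.ResolutionOfSingularities.ResolutionOfSingularities.Theorems.SwitchingDichotomy
open Summit.ResolutionOfSingularities.ResolutionOfSingularities.Theorems.SwitchingDichotomy.K7Hat

/-- **K-β7-hat · `FormalCentreDescent` HOLDS** (β-slot hβ6′): at a stage of a `p = 2` run whose member is regular excellent of
dimension 4 with r.s.o.p. `(x, y, z, w)`, cleaned tangent cone of ODD degree `d ≥ 2` anisotropic over the residue field
and no singular surface, every regular FORMAL centre `V(ι x, ẑ′, ŵ′)` of the hat along which the radicand has formal
order `≥ d` modulo squares is extended from an r.s.o.p.-part prime `(x, z″, w″)` of the member. OURS. -/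
theorem formalCentreDescent_holds : FormalCentreDescent :=
  formalCentreDescent_of K7HatFrame.hatFrame_holds K7HatBranchTransfer.branchTransfer_holds
    BranchFinal.branchObstruction_holds K7HatBranchConclusion.branchConclusion_holds

end Summit.ResolutionOfSingularities.ResolutionOfSingularities.Theorems.SwitchingDichotomy.K7HatFormalCentreDescent
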